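import Summits.ResolutionOfSingularities.ResolutionOfSingularities.Theorems.HilbertSamuelEliminationSigmaMaxModificationsCorridor3SigmaPointCompositionMinLength
import HarnessLib

/-!
# [OURS · L1 W4.2] σ-LAYER PHASE B′ — `Corridor3SigmaPointCompositionIso`: `ℓ` IS INVARIANT UNDER ISOMORPHISMS OF THE BASE — the ℓ-bookkeeping of the
# CURE (curve) step of PHASE B′: blowing up a regular surface `D̃` along a curve `c ⊆ S` (an effective Cartier divisor) is an ISOMORPHISM `D̃′ ≅ D̃`
# (`IsBlowup.isIso`), the configuration becomes `π⁻¹ S` (`⊇` the exceptional trace `π⁻¹ c`), and `ℓ(D̃′, π⁻¹ S) = ℓ(D̃, S)` — so `lex(ℓ, M)` drops through `M`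
# (res-L1-w42-plan-1 CRUX-PLAN w42 v3.13b (4) «curve step … ℓ unchanged»; crux chain w42 `SigmaMaxModifications` stmt-ResolutionOfSingularities-18506 / conjunct
# `SigmaMaxModificationsCorridor3` stmt-ResolutionOfSingularities-19249; helper of res-L1-w42-stub-1 (gen 5), `--supports stmt-…-19249 --as helper`, counted 0)

HONEST FRAMING. OURS bookkeeping over this seat's `…SigmaPointCompositionMinLength` (`ExistsPointCompositionN.transport`, `minLength`, `sncLength`). NOTHING here is
a statement of H. Hironaka's manuscript [Hironaka2017] nor of [CossartJannsenSaito2020]; no named fact. AI-written; AI review is weaker than expert review.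

## Contents (namespace `…Theorems.SigmaMaxModificationsCorridor3.Sigma`)

* `OverPred.restrict_id`, `ExistsPointCompositionN.transport_iff` (base transport along `e : X ≅ Y` is an equivalence for iso-stable `P`),
  **`minLength_transport`** (`minLength (e.inv ⁻¹ T) (P.restrict e.inv) = minLength T P`).
* **`sncLength_preimage_of_iso`** (`e : X′ ≅ X` ⇒ `sncLength (e.hom ⁻¹ T) (e.hom ⁻¹ S) = sncLength T S`) and **`sncLength_preimage_of_isIso`** (the same for
  `π : X′ ⟶ X` with `IsIso π` — the shape the cure step delivers via `IsBlowup.isIso`).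

VACUITY SELF-CHECK. Equalities of natural numbers valid for every `T`, `S`, `P`; nothing is assumed about existence of good compositions (both sides are `0`
together when none exists).
-/

noncomputable section

set_option linter.dupNamespace false -- mandated namespace of this single-conjunct summit

open CategoryTheory AlgebraicGeometry TopologicalSpace
open Literature.AlgebraicGeometry.Resolution

namespace Summit.ResolutionOfSingularities.ResolutionOfSingularities.Theorems.SigmaMaxModificationsCorridor3.Sigma

universe u

open Scheme.IdealSheafData

variable {X : Scheme.{u}} {T : Set X} {P : OverPred X}

/-- Restriction along the identity does nothing. [folklore] -/
@[simp] theorem OverPred.restrict_id (P : OverPred X) : P.restrict (𝟙 X) = P := by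
  funext X' π
  simp only [OverPred.restrict, Category.comp_id]

/-- **Base transport is an equivalence**: along `e : X ≅ Y`, good compositions of length `n` over `T` for `P` correspond to good compositions of length `n` over
`e.inv ⁻¹ T` for `P.restrict e.inv` (iso-stable `P`). [folklore] -/
theorem ExistsPointCompositionN.transport_iff (hP : P.IsoStable) {Y : Scheme.{u}} (e : X ≅ Y) {n : ℕ} :
    ExistsPointCompositionN (e.inv ⁻¹' T) (P.restrict e.inv) n ↔ ExistsPointCompositionN T P n := by
  refine ⟨fun h => ?_, fun h => h.transport hP e⟩
  refine (h.transport (hP.restrict e.inv) e.symm).mono ?_ ?_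
  · intro x hx
    simpa only [Set.mem_preimage, Iso.symm_inv, IsPointBlowupCompositionN.inv_apply_hom_apply] using hx
  · intro X' π hπ
    simpa only [OverPred.restrict_apply, Iso.symm_inv, Category.assoc, e.hom_inv_id, Category.comp_id] using hπ

/-- **`ℓ` is invariant under isomorphisms of the base.** [folklore] -/
theorem minLength_transport (hP : P.IsoStable) {Y : Scheme.{u}} (e : X ≅ Y) :
    minLength (e.inv ⁻¹' T) (P.restrict e.inv) = minLength T P := by
  unfold minLength
  congr 1
  ext n
  exact ExistsPointCompositionN.transport_iff hP e

variable {S : Set X}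

/-- **`ℓ_T(X, S)` along an isomorphism `e : X′ ≅ X`**: `ℓ_{e⁻¹T}(X′, e⁻¹ S) = ℓ_T(X, S)`. [folklore] -/
theorem sncLength_preimage_of_iso {X' : Scheme.{u}} (e : X' ≅ X) : sncLength (e.hom ⁻¹' T) (e.hom ⁻¹' S) = sncLength T S := by
  have h := minLength_transport (T := T) (ResolvesToSnc.isoStable S) e.symm
  rw [ResolvesToSnc.restrict_eq] at h
  exact h

/-- **THE CURE STEP DOES NOT CHANGE `ℓ`**: for `π : X′ ⟶ X` an isomorphism (e.g. the blow-up of a regular surface along an effective Cartier curve,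
`IsBlowup.isIso`), `ℓ_{π⁻¹T}(X′, π⁻¹ S) = ℓ_T(X, S)`. [folklore] -/
theorem sncLength_preimage_of_isIso {X' : Scheme.{u}} (π : X' ⟶ X) [IsIso π] : sncLength (π ⁻¹' T) (π ⁻¹' S) = sncLength T S :=
  sncLength_preimage_of_iso (asIso π)

end Summit.ResolutionOfSingularities.ResolutionOfSingularities.Theorems.SigmaMaxModificationsCorridor3.Sigma

end
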